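import Literature.Probability.LatticeModels.LineTouching
import Literature.Probability.LatticeModels.IsingFiniteEnergy
import HarnessLib

/-!
# Line touching infinitely often (Georgii–Higuchi 2000, Lemma 4.1, last step)

Topic `Probability/LatticeModels`. `LineTouching.lean` proved, for every `μ ∈ 𝒢(β, 0)` with
`β > β_c(2)`: almost surely no infinite `+`cluster (of the lattice or the `∗`-graph) of the upper
half-plane avoids the horizontal axis. Georgii–Higuchi conclude the proof of Lemma 4.1 with:
"Once this is established, we can take the union over all `x` and use the finite energy property
to see that for each finite `Δ` the event 'an infinite `+`cluster in `π_up` is not connected to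
`ℓ_hor` outside `Δ`' also has probability zero, which means that almost surely any infinite
`+`cluster in `π_up` must meet `ℓ_hor` infinitely often." We formalise exactly this:

* `exists_infinite_siteCluster_sdiff` — a deterministic lemma: an infinite cluster keeps an
  infinite sub-cluster after removing a finite set (finitely many pieces touch the set);
* `measure_infinite_cluster_sdiff_not_touching_eq_zero` — for every finite `Δ`, a.s. no infinite
  `+`cluster of `π_up ∖ Δ` avoids the axis (finite energy: freeze `Δ` to `-`);
* **`ae_infinite_cluster_touches_axis_io`** — a.s. every infinite `+`cluster of `π_up` contains
  axis sites outside every box.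

## References

* H.-O. Georgii, Y. Higuchi, J. Math. Phys. 41 (2000), Lemma 4.1 and its proof (p. 11)
  [GeorgiiHiguchi2000].
-/

noncomputable section

open MeasureTheory Filter SimpleGraph
open Literature.Probability.Percolation
open scoped ENNReal

namespace Literature.Probability.LatticeModels

/-! ### Removing a finite set from an infinite cluster -/

section Deterministic

variable {V : Type*} {G : SimpleGraph V}

/-- Sites of a cluster are open. [folklore] -/
theorem mem_of_mem_siteCluster {O : Set V} {x y : V} (h : y ∈ siteCluster G O x) : y ∈ O := h.2.1

/-- Clusters are transitive: the cluster of a member is contained in the cluster. [folklore] -/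
theorem siteCluster_subset_of_mem {O : Set V} {x y : V} (h : y ∈ siteCluster G O x) :
    siteCluster G O y ⊆ siteCluster G O x := fun _ ⟨_, hz, hr⟩ => ⟨h.1, hz, h.2.2.trans hr⟩

/-- A cluster is closed under open adjacency. [folklore] -/
theorem mem_siteCluster_of_adj {O : Set V} {x y z : V} (hy : y ∈ siteCluster G O x) (hz : z ∈ O) (hadj : G.Adj y z) :
    z ∈ siteCluster G O x :=
  ⟨hy.1, hz, hy.2.2.trans (Adj.reachable ((siteOpenGraph_adj _ _ _ _).2 ⟨hadj, hy.2.1, hz⟩))⟩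

/-- A cluster of a smaller open set not adjacent to the removed part is a cluster of the larger
set. [folklore] -/
theorem siteCluster_eq_of_forall_not_adj {O : Set V} (Δ : Finset V) {z : V} (hz : z ∈ O \ ↑Δ)
    (h : ∀ y ∈ siteCluster G (O \ ↑Δ) z, ∀ d ∈ Δ, d ∈ O → ¬ G.Adj y d) :
    siteCluster G O z ⊆ siteCluster G (O \ ↑Δ) z := by
  -- induction along a walk (towards `z`) in the larger open graph
  have key : ∀ (v : V) (q : (siteOpenGraph G O).Walk v z), z ∈ O \ ↑Δ →
      (∀ y ∈ siteCluster G (O \ ↑Δ) z, ∀ d ∈ Δ, d ∈ O → ¬ G.Adj y d) → v ∈ siteCluster G (O \ ↑Δ) z := by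
    clear h hz
    intro v q
    induction q with
    | nil => intro hz' _; exact (mem_siteCluster_self_iff _ _ _).2 hz'
    | cons hadj q' ih =>
      intro hz' h'
      rename_i a b c
      have hb := ih hz' h'
      rw [siteOpenGraph_adj] at hadj
      have haΔ : a ∉ Δ := fun haΔ => h' b hb a haΔ hadj.2.1 hadj.1.symm
      exact mem_siteCluster_of_adj hb ⟨hadj.2.1, fun h'' => haΔ (Finset.mem_coe.1 h'')⟩ hadj.1.symm
  rintro w ⟨-, -, ⟨p⟩⟩
  exact key w p.reverse hz h

/-- **Removing a finite set from an infinite cluster leaves an infinite cluster** (for a locally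
finite graph): some site of the cluster off `Δ` has an infinite cluster in `O ∖ Δ`, contained in
the original cluster. [folklore] -/
theorem exists_infinite_siteCluster_sdiff [G.LocallyFinite] [DecidableEq V] {O : Set V} {x : V}
    (hK : (siteCluster G O x).Infinite) (Δ : Finset V) :
    ∃ z ∈ siteCluster G O x, z ∉ Δ ∧ (siteCluster G (O \ ↑Δ) z).Infinite ∧
      siteCluster G (O \ ↑Δ) z ⊆ siteCluster G O x := by
  classical
  have hsub : ∀ z ∈ siteCluster G O x, siteCluster G (O \ ↑Δ) z ⊆ siteCluster G O x := fun z hz =>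
    (siteCluster_mono Set.sdiff_subset z).trans (siteCluster_subset_of_mem hz)
  by_contra hno
  push Not at hno
  have hfin : ∀ z ∈ siteCluster G O x, z ∉ Δ → (siteCluster G (O \ ↑Δ) z).Finite := fun z hz hzΔ => by
    by_contra h; exact absurd (hsub z hz) (hno z hz hzΔ h)
  -- the neighbours of `Δ`
  set N : Finset V := Δ.biUnion fun d => G.neighborFinset d with hN
  -- every site of the cluster off `Δ` lies in the (finite) cluster of a neighbour of `Δ`, or its
  -- cluster is all of the original cluster
  have hcover : siteCluster G O x ⊆ ↑Δ ∪ ⋃ y ∈ (N : Set V) ∩ siteCluster G O x, siteCluster G (O \ ↑Δ) y := by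
    intro z hz
    by_cases hzΔ : z ∈ Δ
    · exact Or.inl (Finset.mem_coe.2 hzΔ)
    right
    have hzO : z ∈ O \ ↑Δ := ⟨mem_of_mem_siteCluster hz, fun h => hzΔ (Finset.mem_coe.1 h)⟩
    by_cases hadjΔ : ∃ y ∈ siteCluster G (O \ ↑Δ) z, ∃ d ∈ Δ, d ∈ O ∧ G.Adj y d
    · obtain ⟨y, hy, d, hd, -, hyd⟩ := hadjΔ
      have hyN : y ∈ (N : Set V) := by
        rw [Finset.mem_coe, hN, Finset.mem_biUnion]
        exact ⟨d, hd, (G.mem_neighborFinset d y).2 hyd.symm⟩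
      refine Set.mem_biUnion ⟨hyN, hsub z hz hy⟩ ?_
      -- `z` is in the cluster of `y` (symmetry of clusters in `O ∖ Δ`)
      exact ⟨hy.2.1, hzO, hy.2.2.symm⟩
    · push Not at hadjΔ
      -- the cluster of `z` in `O ∖ Δ` is the whole cluster: contradiction with finiteness
      exfalso
      have heq := siteCluster_eq_of_forall_not_adj Δ hzO (fun y hy d hd hdO => hadjΔ y hy d hd hdO)
      have hzx : siteCluster G O x ⊆ siteCluster G O z := siteCluster_subset_of_mem ⟨hz.2.1, hz.1, hz.2.2.symm⟩
      exact hK ((hfin z hz hzΔ).subset (hzx.trans heq))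
  refine hK (Set.Finite.subset ?_ hcover)
  refine (Finset.finite_toSet Δ).union (Set.Finite.biUnion ((Finset.finite_toSet N).inter_of_left _) fun y hy => ?_)
  by_cases hyΔ : y ∈ Δ
  · have : siteCluster G (O \ ↑Δ) y = ∅ := by
      ext w
      simp only [siteCluster, Set.mem_setOf_eq, Set.mem_empty_iff_false, iff_false, not_and, Set.mem_sdiff, Finset.mem_coe]
      exact fun h _ => absurd hyΔ h.2
    rw [this]; exact Set.finite_empty
  · exact hfin y hy.2 hyΔ

end Deterministic

/-! ### Line touching outside a finite set -/

variable {β : ℝ} {G : SimpleGraph (Site 2)} {μ : Measure (SpinConfig (Site 2))}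

/-- Freezing `Δ` to `-` removes `Δ` from the `+`sites. [folklore] -/
theorem spinSites_one_glueWith_neg (Δ : Finset (Site 2)) (ω : SpinConfig (Site 2)) :
    spinSites 1 (glueWith Δ (fun _ => (-1 : ℤˣ)) ω) = spinSites 1 ω \ ↑Δ := by
  ext z
  simp only [mem_spinSites, Set.mem_sdiff, Finset.mem_coe]
  by_cases hz : z ∈ Δ
  · rw [glueWith_apply_mem _ _ _ hz]; simp [hz]
  · rw [glueWith_apply_not_mem _ _ _ hz]; simp [hz]

/-- **No infinite `+`cluster of `π_up ∖ Δ` avoids the axis**, for every finite `Δ`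
(Georgii–Higuchi 2000, proof of Lemma 4.1: "use the finite energy property"). [cite: GeorgiiHiguchi2000, Lemma 4.1 (proof, p. 11)] -/
theorem measure_infinite_cluster_sdiff_not_touching_eq_zero (hβc : criticalBeta 2 < β) (hnn : zdGraph 2 ≤ G)
    (hst : G ≤ zdStarGraph) (hμ : μ ∈ isingGibbsMeasures 2 β 0) (Δ : Finset (Site 2)) :
    μ {ω | ∃ x, (siteCluster G (spinSites 1 ω ∩ (halfPlane 0 \ ↑Δ)) x).Infinite ∧
      ∀ y ∈ siteCluster G (spinSites 1 ω ∩ (halfPlane 0 \ ↑Δ)) x, y 1 ≠ 0} = 0 := by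
  have hμG : IsGibbsMeasure (isingSpecification (zdGraph 2) β 0) μ := hμ
  set E₀ : Set (SpinConfig (Site 2)) := {ω | ∃ x, (siteCluster G (spinSites 1 ω ∩ halfPlane 0) x).Infinite ∧
      ∀ y ∈ siteCluster G (spinSites 1 ω ∩ halfPlane 0) x, y 1 ≠ 0} with hE₀
  have h0 : μ E₀ = 0 := measure_infinite_cluster_not_touching_eq_zero hβc hnn hst hμ
  set S := toMeasurable μ E₀ with hS
  have hS0 : μ S = 0 := by rw [hS, measure_toMeasurable]; exact h0
  -- the frozen configuration lies in `E₀`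
  have hsub : {ω : SpinConfig (Site 2) | ∃ x, (siteCluster G (spinSites 1 ω ∩ (halfPlane 0 \ ↑Δ)) x).Infinite ∧
      ∀ y ∈ siteCluster G (spinSites 1 ω ∩ (halfPlane 0 \ ↑Δ)) x, y 1 ≠ 0} ⊆
      {ω | glueWith Δ (fun _ => (-1 : ℤˣ)) ω ∈ S} := by
    rintro ω ⟨x, hinf, hax⟩
    refine subset_toMeasurable μ E₀ ⟨x, ?_⟩
    have heq : spinSites 1 (glueWith Δ (fun _ => (-1 : ℤˣ)) ω) ∩ halfPlane 0 = spinSites 1 ω ∩ (halfPlane 0 \ ↑Δ) := by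
      rw [spinSites_one_glueWith_neg]; ext z; simp only [Set.mem_inter_iff, Set.mem_sdiff]; tauto
    rw [heq]
    exact ⟨hinf, hax⟩
  refine measure_mono_null hsub ?_
  by_contra hne
  exact (hμG.measure_ne_zero_of_glueWith (zdGraph 2) Δ (fun _ => (-1 : ℤˣ)) (measurableSet_toMeasurable μ E₀) hne) hS0

/-- **Line touching infinitely often** (Georgii–Higuchi 2000, Lemma 4.1, second statement): for
`β > β_c(2)` and every `μ ∈ 𝒢(β, 0)`, almost surely every infinite `+`cluster of the upper
half-plane (of `G = ` the lattice or the `∗`-graph) contains sites of the horizontal axis outside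
every box. [cite: GeorgiiHiguchi2000, Lemma 4.1] -/
theorem ae_infinite_cluster_touches_axis_io [G.LocallyFinite] (hβc : criticalBeta 2 < β) (hnn : zdGraph 2 ≤ G)
    (hst : G ≤ zdStarGraph) (hμ : μ ∈ isingGibbsMeasures 2 β 0) :
    ∀ᵐ ω ∂μ, ∀ x, (siteCluster G (spinSites 1 ω ∩ halfPlane 0) x).Infinite →
      ∀ n : ℕ, ∃ y ∈ siteCluster G (spinSites 1 ω ∩ halfPlane 0) x, y 1 = 0 ∧ (n : ℤ) < |y 0| := by
  classical
  have hall : ∀ᵐ ω ∂μ, ∀ n : ℕ, ω ∉ {ω : SpinConfig (Site 2) | ∃ x,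
      (siteCluster G (spinSites 1 ω ∩ (halfPlane 0 \ ↑(box 2 n))) x).Infinite ∧
        ∀ y ∈ siteCluster G (spinSites 1 ω ∩ (halfPlane 0 \ ↑(box 2 n))) x, y 1 ≠ 0} := by
    rw [ae_all_iff]
    intro n
    have h := measure_infinite_cluster_sdiff_not_touching_eq_zero hβc hnn hst hμ (box 2 n)
    rw [ae_iff]
    simpa using h
  filter_upwards [hall] with ω hω x hinf n
  obtain ⟨z, hz, -, hzinf, hzsub⟩ := exists_infinite_siteCluster_sdiff hinf (box 2 n)
  have heq : (spinSites 1 ω ∩ halfPlane 0) \ ↑(box 2 n) = spinSites 1 ω ∩ (halfPlane 0 \ ↑(box 2 n)) := by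
    ext w; simp only [Set.mem_sdiff, Set.mem_inter_iff]; tauto
  rw [heq] at hzinf hzsub
  have hn := hω n
  simp only [not_exists, not_and, not_forall, not_not] at hn
  obtain ⟨y, hy, hy1⟩ := hn z hzinf
  refine ⟨y, hzsub hy, hy1, ?_⟩
  have hybox : y ∉ box 2 n := fun h => (mem_of_mem_siteCluster hy).2.2 (Finset.mem_coe.2 h)
  rw [mem_box] at hybox
  push Not at hybox
  obtain ⟨i, hi⟩ := hybox
  fin_cases i
  · change -(n : ℤ) ≤ y 0 → (n : ℤ) < y 0 at hi
    rw [lt_abs]; by_cases h : -(n : ℤ) ≤ y 0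
    · exact Or.inl (hi h)
    · right; omega
  · change -(n : ℤ) ≤ y 1 → (n : ℤ) < y 1 at hi
    exfalso; rw [hy1] at hi; have := hi (by omega); omega

end Literature.Probability.LatticeModels
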